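import Summits.QuantumFields.QCD.Theorems.SmallFieldUltracontractivity.Negative.Tightness
import Literature.Probability.LatticeModels.TorusFourierProofs

/-!
# Line `point-centred-axial-parabolic` — LEAD skeleton for the crux `SmallFieldUltracontractivity`
(item stmt-QuantumFields-8871, route `HeatSlicedQuarks`, rank-2 crux; line lead
prover-line-stmt-QuantumFields-8871-0, 2026-08-16; reshaped from the crux-plan skeleton of
planner-cruxplan-stmt-QuantumFields-8871-point-centred-axial--0)

Crux (by name, never restated as a target): `Summit.QuantumFields.QCD.Theses.HeatSlicedQuarks.SmallFieldUltracontractivity`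
— `∃ ε > 0, K, C` such that on every torus, for every `SU(3)` field `U`, mass `m ∈ [-1/2, 1]`, site `x`,
scale `1 ≤ r ≤ L`: plaquette deficits `3 - Re tr U_p ≤ (ε/r²)²` on the `torusDist`-ball of radius `K·r`
around `x` imply `|e^{-t D_Wᴴ D_W}((x,a,α),(x,b,β))| ≤ C/t²` for `1 ≤ t ≤ r²`.

## The line (idea `point-centred-axial-parabolic`)

LEVER: in the complete axial ("comb") gauge centred at `x` on a non-wrapping cube, plaquette
smallness `δ` becomes LINK smallness growing linearly with the distance (`stub_combGauge`), so at the
working scale `ρ ≍ √s ≤ ℓ` the perturbation `E := D_W(U) - D_W(1)` is a bounded hopping operator of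
size `≍ κ/ℓ ≤ κ/ρ`; the dimensionless coupling is geometric in the scale (scale covariance, the
Disproof's §B near-miss).  ENGINE: the T*T / sup-principle form of the crux (Disproof §C; Tightness
`exp_neg_smul_apply_self_eq_sum_norm_sq`) is a LOCAL `ℓ² → ℓ^∞` bound for `u(τ) = e^{-τH_U} f`
("LocalSupBound", the conclusion of `stub_caloricBootstrap`), proved by ONE cut-off Duhamel step around
the FREE MASSIVE Wilson kernel (`stub_freeKernelDecay`: parabolic polynomial decay of the free kernel and
of its nearest-neighbour differences, with the mass decay `e^{-cσm²}`) and closed as a sup-norm fixed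
point `M ≤ C₀ + C₁(κ + κ²)M` (`stub_caloricBootstrap`, the research content); the free comparison
operator is the MASSIVE free operator `D₁ = wilsonDirac ρ 1 m 1` (never split `m` off:
`H_U - H₁ = D₁ᴴE + EᴴD_U`), `E` is never differenced (the free difference always lands on the free
kernel, paid by `√(1+σ)`), the derivative on `u` is handled by the `Q_U = γ₅D_U` trick, the exterior of
the ball enters only through `‖e^{-τH_U}‖_{2→2} ≤ 1`.  TRANSFER: gauge covariance of the colour-summed
diagonal (`stub_gaugeCovariance`), monotonicity of the diagonal in `t` (`stub_diagonalMonotone`), comb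
gauge + scale arithmetic (`stub_gaugeTransfer`).

## Stubs (7) and composition (lead's reshape, 2026-08-16; statements written out, no local `def`s, so
that each stub lands verbatim as `Theorems/HeatSlicedQuarksSmallFieldUltracontractivity<Stub>.lean`)

* `stub_combGauge`         (M)  — "CombGauge" (unchanged from the plan).
* `stub_freeKernelFourier` (S/M) — "FreeKernelFourier": the massive free heat kernel in torus Fourier variables
  (the tree's `exp_freeWilson_apply` with the mass restored).
* `stub_freeKernelDecay`   (L)  — "FreeKernelFourier → FreeKernelDecay" (replaces the plan's exponential `FreeKernelEnvelope`:
  parabolic polynomial decay `(1+σ)/(1+σ+d²)³` for entries and `√(1+σ)/(1+σ+d²)³` for nearest-neighbour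
  column differences, both with `e^{-cσm²}` — exactly what the bootstrap consumes; real-variable Fourier
  analysis, six `p`-derivatives of the symbol, no contour shift).
* `stub_caloricBootstrap`  (L+, HARDEST, lead) — "FreeKernelDecay → LocalSupBound" (`LocalSupBound` now
  carries the non-wrapping side condition `4ℓ < L`).
* `stub_gaugeCovariance`   (S)  — "GaugeCovariance": colour-summed diagonal heat-kernel blocks and
  plaquette traces are gauge invariant (pure algebra over `wilsonDirac_gaugeTransform`).
* `stub_diagonalMonotone`  (S)  — "DiagonalMonotone": `t ↦ Re e^{-tAᴴA}(i,i)` is non-increasing.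
* `stub_gaugeTransfer`     (M)  — "CombGauge → GaugeCovariance → DiagonalMonotone → LocalSupBound →
  DiagonalKernelBound": scale arithmetic only.
* `SmallFieldUltracontractivity_of` (kernel-checked, no `sorry` of its own): uses the seven stubs BY NAME and
  concludes the crux decl BY NAME (all colour–spin entries from the diagonal real parts by the landed
  `norm_sq_exp_neg_smul_apply_le`, `exp_neg_smul_apply_self_eq_sum_norm_sq`).

## Disproof.lean honoured

`smallFieldUltracontractivity_false_without_t_le_rsq`: `t ≤ r²` is consumed in `stub_gaugeTransfer`
(comb cube of radius `2ℓ+1`, `ℓ ≍ √t/16`, inside the flat `r`-ball) and in LocalSupBound /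
FreeKernelDecay through `s ≤ ℓ² < L²/16` (torus zero mode `L⁻⁴ ≲ (1+σ)⁻²`);
`…_false_without_r_le_L`: consumed by the non-wrapping conditions `4ℓ + 3 ≤ r ≤ L` / `4ℓ < L`;
`…_false_without_one_le_t`: cosmetic (small `t` trivial by `kernelEntry_le_one`);
`body_holds_at_fixed_volume`: all constants are `L`-free; `not_smallFieldUltracontractivityExp`: every
stub outputs exactly `s⁻²`/`t⁻²`; near-miss `not_admissibleOnlyUltracontractivity` (§B): the coupling
`κ ≍ δℓ²` of the bootstrap diverges for a flat `ε` — scale covariance is used in `stub_gaugeTransfer`;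
§C sup principle = LocalSupBound; §E: no targets filed.
-/

namespace Summit.QuantumFields.QCD.Cruxes.SmallFieldUltracontractivity.PointCentredAxialParabolic

open Literature.MathematicalPhysics.QuantumLattice Literature.MathematicalPhysics.QuantumFieldTheory
open Literature.Probability.LatticeModels (TorusSite torusChar)
open Summit.QuantumFields.QCD.Theorems.SmallFieldUltracontractivity.Negative
open scoped Matrix ComplexConjugate


/-! ### §1 The registered stubs (`sorry` ONLY here; every statement written out in tree vocabulary) -/

/-- **Stub S1 (M) "CombGauge" — point-centred complete axial (comb) gauge on a non-wrapping cube.**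
If the cube of `torusDist`-radius `R` around `x` does not wrap (`2R + 1 ≤ L`) and every plaquette
based in it has deficit `3 - Re tr U_p ≤ δ²`, then some lattice gauge transformation `g` makes every
positively oriented link based at a point `z` with `torusDist x z + 1 ≤ R` satisfy
`3 - Re tr (g•U)(z,μ) ≤ C_A (torusDist x z + 1)² δ²` (absolute `C_A`; `9` works with Frobenius norms,
`27` with operator norms).
WHY TRUE: maximal comb tree (direction-3 links everywhere, direction-2 links on `{z₃ = x₃}`,
direction-1 links on `{z₂ = x₂, z₃ = x₃}`, direction-0 links on the axis through `x`), `g(x) = 1`,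
`g` = transport along the tree (the short way round each axis — unambiguous since `2R+1 ≤ L`); a tree
link is gauged to `1`, a non-tree link `(z, μ)` is gauged to the holonomy of the ladder between the comb
paths to `z` and `z + μ̂`: a product of `≤ Σ_{ν>μ} |z_ν - x_ν| ≤ 3·torusDist x z` plaquette holonomies,
each conjugated by a unitary and each within `‖1 - U_p‖_F = √(2·deficit) ≤ √2 δ` of `1`
(`‖AB - 1‖ ≤ ‖A - 1‖ + ‖B - 1‖` for unitaries); deficit `= ½‖W - 1‖_F² ≤ 9 dist² δ²`.
The side condition is NECESSARY (torons on wrapping cubes).  SIZE: M.  LEANS ON: `gaugeTransform`,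
`plaquetteHolonomy`, `lineHolonomy`, `torusDist` (+ `torusDist_triangle'`, `torusDist_comm'` of
`LatticeToriProofs`), `fundamentalRep`. -/
theorem stub_combGauge :
    ∃ C_A : ℝ, ∀ (L : ℕ) [NeZero L] (U : GaugeConfig 4 L SU3) (x : TorusSite 4 L) (R : ℕ),
      2 * R + 1 ≤ L → ∀ δ : ℝ, 0 ≤ δ →
      (∀ y : TorusSite 4 L, torusDist x y ≤ R → ∀ μ ν : Fin 4,
        3 - ((fundamentalRep (Fin 3)) (plaquetteHolonomy U y μ ν)).trace.re ≤ δ ^ 2) →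
      ∃ g : TorusSite 4 L → SU3, ∀ z : TorusSite 4 L, torusDist x z + 1 ≤ R → ∀ μ : Fin 4,
        3 - ((fundamentalRep (Fin 3)) (gaugeTransform g U (z, μ))).trace.re
          ≤ C_A * ((torusDist x z : ℝ) + 1) ^ 2 * δ ^ 2 := by
  sorry

/-- **Stub S2a (S/M) "FreeKernelFourier" — the free MASSIVE Wilson heat kernel in torus Fourier variables.**
For `U ≡ 1` (`freeCfg L`), `r_W = 1`, every real `m`, `σ` and all indices:
`e^{-σ D₁ᴴD₁}((x,a,α),(z,b,β)) = δ_{(a,α),(b,β)} · L⁻⁴ Σ_k e^{-σ h_m(k)} χ_k(x) conj χ_k(z)` with the SCALAR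
symbol `h_m(k) = (m + Σ_μ (1 − cos θ_μ))² + Σ_μ sin² θ_μ`, `θ_μ = 2π k_μ.val / L`.  This is the `m = 0` theorem
`exp_freeWilson_apply` of `HeatSlicedQuarksFreeKernelPowerCountingFourier` with the mass restored:
`wilsonDirac ρ U m 1 = (m : ℂ) • 1 + wilsonDirac ρ U 0 1` (both sides of `wilsonDirac_eq_sub_sum_wilsonHop`),
so `D_m P = P (1 ⊗ (m + M(k)))` with `M(k) = W(k)·1 + iΣ_μ sin θ_μ γ_μ` (`wilsonDirac_one_mul_planeP`), and
`(m + M(k))ᴴ(m + M(k)) = h_m(k)·1` is `clifford_conjTranspose_mul_self (m + W) s`; then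
`exp_neg_smul_conjTranspose_mul_self_apply` with `planeP_conjTranspose_mul_self`.  (`freeCfg L` and
`(1 : GaugeConfig 4 L SU3)` are definitionally equal.)  SIZE: S/M.  LEANS ON: the three files named
(namespaces `Summit.QuantumFields.QCD.Theorems.HeatSlicedQuarks.FreeKernel`,
`Summit.QuantumFields.QCD.Cruxes.TipNoBinding.PositivityNoLeakSpread`), `torusChar` API of
`Literature.Probability.LatticeModels.TorusFourierProofs`. -/
theorem stub_freeKernelFourier :
    ∀ (L : ℕ) [NeZero L] (m σ : ℝ) (x z : TorusSite 4 L) (a b : Fin 3) (α β : Fin 4),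
      (NormedSpace.exp (-(σ : ℂ) •
          ((wilsonDirac (fundamentalRep (Fin 3)) (freeCfg L) m 1)ᴴ *
            wilsonDirac (fundamentalRep (Fin 3)) (freeCfg L) m 1))) (x, a, α) (z, b, β) =
        if (a, α) = (b, β) then
          ∑ k : TorusSite 4 L, ((L : ℂ) ^ 2)⁻¹ * ((L : ℂ) ^ 2)⁻¹ *
            (Complex.exp (-(σ : ℂ) *
              (((m + ∑ μ : Fin 4, (1 - Real.cos (2 * Real.pi * (ZMod.val (k μ) : ℝ) / L))) ^ 2 +
                  ∑ μ : Fin 4, Real.sin (2 * Real.pi * (ZMod.val (k μ) : ℝ) / L) ^ 2 : ℝ) : ℂ)) *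
              (torusChar k x * conj (torusChar k z)))
        else 0 := by
  sorry

/-- **Stub S2b (L) "FreeKernelFourier → FreeKernelDecay" — parabolic polynomial decay of the free MASSIVE Wilson heat kernel
on the torus, and a half-derivative gain for its nearest-neighbour column differences.**  For `U ≡ 1`
(`freeCfg L`), `r_W = 1`, every `m ∈ [-1/2, 1]`, `0 ≤ σ ≤ L²`, with `d = torusDist x z`:
`|e^{-σH₁}((x,a,α),(z,b,β))| ≤ C e^{-cσm²} (1+σ)/(1+σ+d²)³` and, for every direction `μ`,
`|e^{-σH₁}((x,a,α),(z,b,β)) - e^{-σH₁}((x,a,α),(z+μ̂,b,β))| ≤ C e^{-cσm²} √(1+σ)/(1+σ+d²)³`.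
WHY TRUE: `H₁ = D₁ᴴD₁` (`D₁ = wilsonDirac ρ 1 m 1 = m·1 + D₀`) is diagonalised by plane waves with the
SCALAR symbol `h_m(p) = (m + W)² + Σ_μ sin² p_μ`, `W = Σ_μ (1 - cos p_μ)` (tree:
`exp_freeWilson_apply` is the `m = 0` case; `clifford_conjTranspose_mul_self (m + W) s` does general `m`);
`h_m = m² + 2(1+m)W + Σ_{μ≠ν} w_μ w_ν ≥ m² + W(p)` on the mass window (cf. `symbol_sq_lower_bound`), so
`e^{-σh_m} = e^{-σm²} e^{-σ g_m}`, `g_m ≥ W = ½|p̂|²`; the Fourier sum gives `|k_σ| ≤ L⁻⁴Σ_p e^{-σh_m}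
≤ C e^{-σm²}(1+σ)⁻²` (Gaussian Riemann sums as in `HeatSlicedQuarksFreeKernelPowerCountingBounds`; the
zero mode `L⁻⁴ ≤ 4(1+σ)⁻²` because `σ ≤ L²`), and multiplying `k_σ(z)` by `(e^{2πi z_μ/L} - 1)ⁿ`
shifts the momentum sum, i.e. applies the `n`-th finite difference (step `2π/L`) to `e^{-σh_m}` in
`p_μ`, bounded by `(2π/L)ⁿ sup |∂ⁿ_μ e^{-σh_m}| ≤ Cₙ (2π/L)ⁿ e^{-σm²}(1+σ)^{n/2} e^{-σW/4}` (each
`p`-derivative costs `√(1+σ)`: `σ|∂h| ≲ σ|p̂| ≲ √σ` on the Gaussian); with `|e^{2πiz_μ/L} - 1| ≥ 4|z_μ|_per/L`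
this is `|z_μ|ⁿ_per |k_σ(z)| ≤ Cₙ e^{-σm²}(1+σ)^{n/2-2}`, `n = 6`, whence the first bound
(`min((1+σ)⁻², (1+σ)d⁻⁶) ≤ 8(1+σ)/(1+σ+d²)³`); the difference has symbol `(1 - e^{∓ip_μ})e^{-σh_m}`, one
more `|p̂|`, hence `√(1+σ)` more decay and no zero-mode term.  (Cauchy estimates in the complexified
`p_μ` give all `n` at once: `Re h_m(p + iη e_μ) ≥ h_m(p)/2 - C η²` for `|η| ≤ 1`.)
SIZE: L.  LEANS ON: `HeatSlicedQuarksFreeKernelPowerCountingFourier` (`exp_neg_smul_conjTranspose_mul_self_apply`,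
`planeP_conjTranspose_mul_self`, `wilsonDirac_one_mul_planeP`), `SpectralDefectExtinctionTipNoBindingFreeSymbol`
(`clifford_conjTranspose_mul_self`, `torusChar`, `symbol_sq_lower_bound`-style SOS),
`HeatSlicedQuarksFreeKernelPowerCountingBounds` (`sum_torus_prod_eq_pow`, `sum_range_exp_neg_mul_sq_succ_le`,
`exp_neg_sin_sq_le`), Mathlib `iteratedDeriv` / Taylor–Lagrange (`taylor_mean_remainder_lagrange`) or
Cauchy estimates. -/
theorem stub_freeKernelDecay :
    (∀ (L : ℕ) [NeZero L] (m σ : ℝ) (x z : TorusSite 4 L) (a b : Fin 3) (α β : Fin 4),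
      (NormedSpace.exp (-(σ : ℂ) •
          ((wilsonDirac (fundamentalRep (Fin 3)) (freeCfg L) m 1)ᴴ *
            wilsonDirac (fundamentalRep (Fin 3)) (freeCfg L) m 1))) (x, a, α) (z, b, β) =
        if (a, α) = (b, β) then
          ∑ k : TorusSite 4 L, ((L : ℂ) ^ 2)⁻¹ * ((L : ℂ) ^ 2)⁻¹ *
            (Complex.exp (-(σ : ℂ) *
              (((m + ∑ μ : Fin 4, (1 - Real.cos (2 * Real.pi * (ZMod.val (k μ) : ℝ) / L))) ^ 2 +
                  ∑ μ : Fin 4, Real.sin (2 * Real.pi * (ZMod.val (k μ) : ℝ) / L) ^ 2 : ℝ) : ℂ)) *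
              (torusChar k x * conj (torusChar k z)))
        else 0) →
    (∃ C c : ℝ, 0 < c ∧ ∀ (L : ℕ) [NeZero L] (m : ℝ), m ∈ Set.Icc (-(1 / 2 : ℝ)) 1 →
      ∀ σ : ℝ, 0 ≤ σ → σ ≤ (L : ℝ) ^ 2 →
      ∀ (x z : TorusSite 4 L) (a b : Fin 3) (α β : Fin 4),
        ‖(NormedSpace.exp (-(σ : ℂ) •
            ((wilsonDirac (fundamentalRep (Fin 3)) (freeCfg L) m 1)ᴴ *
              wilsonDirac (fundamentalRep (Fin 3)) (freeCfg L) m 1))) (x, a, α) (z, b, β)‖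
          ≤ C * Real.exp (-(c * σ * m ^ 2)) * (1 + σ) / (1 + σ + (torusDist x z : ℝ) ^ 2) ^ 3 ∧
        ∀ μ : Fin 4,
          ‖(NormedSpace.exp (-(σ : ℂ) •
              ((wilsonDirac (fundamentalRep (Fin 3)) (freeCfg L) m 1)ᴴ *
                wilsonDirac (fundamentalRep (Fin 3)) (freeCfg L) m 1))) (x, a, α) (z, b, β) -
            (NormedSpace.exp (-(σ : ℂ) •
              ((wilsonDirac (fundamentalRep (Fin 3)) (freeCfg L) m 1)ᴴ *
                wilsonDirac (fundamentalRep (Fin 3)) (freeCfg L) m 1))) (x, a, α) (Site.shift z μ, b, β)‖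
          ≤ C * Real.exp (-(c * σ * m ^ 2)) * Real.sqrt (1 + σ) / (1 + σ + (torusDist x z : ℝ) ^ 2) ^ 3) := by
  sorry

/-- **Stub S3 (L+, HARDEST — the research content of the line, held by the lead)
"FreeKernelDecay → LocalSupBound": the caloric sup-norm bootstrap.**
CONCLUSION ("LocalSupBound", the gauge-fixed local sup bound, T*T / sup-principle form): `∃ κ > 0, C`: if
the cube of radius `2ℓ` around `x` does not wrap (`4ℓ < L`), every link based within `torusDist ≤ 2ℓ` of
`x` has deficit `3 - Re tr U(z,μ) ≤ (κ/ℓ)²` (link flatness, what the comb gauge delivers) and every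
plaquette based there has deficit `≤ (κ/ℓ²)²` (insurance), with `1 ≤ ℓ`, then for `1 ≤ s ≤ ℓ²` the row
of `e^{-sH_U}` at `(x,a,α)` has `ℓ²`-norm `≤ C/s` — equivalently `|(e^{-sH_U}f)(x,a,α)| ≤ (C/s)‖f‖₂`; by
T*T the diagonal entry at time `2s` is `≤ (C/s)²`.  The exterior of the ball is ARBITRARY.
PROOF PLAN (lead, 2026-08-16).  Notation: `D_U = wilsonDirac ρ U m 1`, `D₁ = wilsonDirac ρ 1 m 1`
(MASSIVE free operator), `H_U = D_Uᴴ D_U`, `H₁ = D₁ᴴ D₁`, `K_σ = e^{-σH₁}`, `P_τ = e^{-τH_U}`,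
`E = D_U - D₁` (a nearest-neighbour hopping matrix with colour blocks `U(z,μ) - 1`, NO diagonal: on the
cube `B(x,2ℓ)` its entries are `≤ λ := √2 κ/ℓ`), `V := H_U - H₁ = D₁ᴴE + EᴴD_U`.
(1) CUT-OFF DUHAMEL (matrix FTC).  `χ` = product cutoff `Π_μ φ((z_μ - x_μ)/ρ)` (`φ ∈ C²`, `φ = 1` on
`[-1/4,1/4]`, `supp ⊂ [-1/2,1/2]`; coordinates read in `(-L/2, L/2]`, legitimate as `4ℓ < L`), so
`|∇χ| ≤ c₁/ρ`, `|∇²χ| ≤ c₂/ρ²`, `supp χ ⊂ B(x, ρ/2)` (a `torusDist`-cube); `θ` = time ramp, `0` on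
`[0,s/4]`, `1` on `[s/2,s]`, slope `4/s`.  With `w(τ) = θ(τ) M_χ P_τ f`,
`d/dτ (K_{s-τ} w(τ)) = K_{s-τ}[θ([H₁,M_χ] - M_χ V) P_τ f + θ' M_χ P_τ f]`, and integrating on
`[s/4, s]` (two affine pieces): `(P_s f)(x,a,α) = T1 + T2 + T3`,
`T1 = ∫ θ' (K_{s-τ}M_χP_τf)(x)`, `T2 = -∫ θ (K_{s-τ}M_χ V P_τ f)(x)`, `T3 = ∫ θ (K_{s-τ}[H₁,M_χ]P_τ f)(x)`.
(2) FREE TERMS from FreeKernelDecay + `sum_radial_le`/`card_filter_torusDist_eq_le`: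
row `ℓ²` norm `‖K_σ(x,·)‖₂ ≤ C/(1+σ)` ⇒ `|T1| ≤ (4/s)(s/4) sup_{σ≥s/2} ‖K_σ(x,·)‖₂ ‖f‖ ≤ C‖f‖/s`;
`[H₁,M_χ]`: entries `Σ_z k_σ(x,z) h₁(z,z')(χ(z') - χ(z))` on the fattened annulus, Taylor `χ` to second
order and `k` to first order (first moments `Σ_e h₁(e) e = ∂_p h_m(0) = 0`, `h_m` even), using
`|k_σ| ≤ C(1+σ)/(1+σ+d²)³ ≤ Cρ⁻⁴`, `|∇k_σ| ≤ C√(1+σ)/(1+σ+d²)³ ≤ Cρ⁻⁵` at `d ≥ ρ/4 - 2`, `σ ≤ s ≤ ρ²`: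
row entries `O(ρ⁻⁶)` on `O(ρ⁴)` sites ⇒ `‖row‖₂ ≤ Cρ⁻⁴` ⇒ `|T3| ≤ s·Cρ⁻⁴‖f‖ ≤ C‖f‖/s` (`ρ² ≍ s`).
(3) PERTURBATIVE TERM `T2` against the bootstrap constant `M(S) := sup{ s|(P_s f)(x,a,α)|/‖f‖₂ :
admissible (L,U,m,x,ℓ,s), s ≤ S }` (`≤ S`, finite): (a) `K_σM_χD₁ᴴ(E u)`: move `D₁ᴴ` onto the row
(`D₁ᴴ = m + D₀ᴴ`, `D₀ᴴ` = combination of nearest-neighbour differences): `‖row(K_σM_χD₀ᴴ)‖₁ ≤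
C/√(1+σ) + Cρ⁻¹` (difference bound, radial sum without log), `‖row(m K_σM_χ)‖₁ ≤ C|m|e^{-cσm²}`
(entry bound, radial sum O(1)); `∫₀^s (C/√(1+σ) + C|m|e^{-cσm²}) dσ ≤ C√s` (the mass integral is
`≤ C min(s|m|, 1/|m|) ≤ C√s` — THIS is why S2 carries `e^{-cσm²}`); times `‖Eu‖_∞ ≤ 8λ sup_Q|u|`,
`sup_Q |u| ≤ 8M‖f‖/s` by HEREDITARY admissibility (`z ∈ B(x,ρ/2+1)`, `τ ∈ [s/4,s]`: `B(z,2ℓ') ⊂ B(x,2ℓ)`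
with `ℓ' = ⌊ℓ/2⌋ ≥ ρ`, tolerances monotone, `4ℓ' < L`) ⇒ `≤ C√s (κ/ρ) M‖f‖/s ≤ CκM‖f‖/s`;
(b) `K_σM_χEᴴ(D_U u)`: `‖row(K_σM_χ)‖₁ ≤ C`, `‖Eᴴ‖ ≤ 8λ`, and the `Q_U` trick (`Q_U := Γ₅D_U`
Hermitian, `Q_U² = H_U`: `isHermitian_gammaFive_mul_wilsonDirac`, `hermitianWilsonDirac_mul_self`):
`D_U P_τ f = Γ₅ P_{τ/2}(Q_U P_{τ/2} f)`, `‖Q_U P_{τ/2} f‖₂ ≤ (eτ)^{-1/2}‖f‖₂`, admissible sup bound at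
`(z, τ/2)` ⇒ `sup_Q |D_U u| ≤ CM‖f‖ s^{-3/2}` ⇒ `≤ s·(κ/ρ)·CM‖f‖s^{-3/2} = CκM‖f‖/s`.
(4) FIXED POINT: `M(S) ≤ max(s₀, C₀ + C₁κ M(S))`, `κ ≤ 1/(2C₁)` ⇒ `M ≤ 2C₀ + s₀`; small `s < s₀` and the
window `c₀ℓ² < s ≤ ℓ²` by `|u| ≤ ‖f‖` resp. monotonicity of `Σ_j|e^{-sH}(i,j)|² = e^{-2sH}(i,i)`.
LOG-FREE, ROUGH-FIELD-SAFE (`E` never differenced), exponent exact, NO spectral gap of `H_U` assumed.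
SIZE: L+.  LEANS ON: S2, `LatticeToriProofs` (`torusDist_triangle'`, `sum_radial_le`,
`card_filter_torusDist_eq_le`), `l2_opNorm_wilsonDirac_le`, `opNorm_toEuclideanCLM_exp_le`,
γ₅-hermiticity (above), `Matrix.exp_add_of_commute`, `hasDerivAt_exp_smul_const'`,
`intervalIntegral.integral_eq_sub_of_hasDerivAt`, `Matrix.IsHermitian.spectral_theorem`. -/
theorem stub_caloricBootstrap :
    (∃ C c : ℝ, 0 < c ∧ ∀ (L : ℕ) [NeZero L] (m : ℝ), m ∈ Set.Icc (-(1 / 2 : ℝ)) 1 →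
      ∀ σ : ℝ, 0 ≤ σ → σ ≤ (L : ℝ) ^ 2 →
      ∀ (x z : TorusSite 4 L) (a b : Fin 3) (α β : Fin 4),
        ‖(NormedSpace.exp (-(σ : ℂ) •
            ((wilsonDirac (fundamentalRep (Fin 3)) (freeCfg L) m 1)ᴴ *
              wilsonDirac (fundamentalRep (Fin 3)) (freeCfg L) m 1))) (x, a, α) (z, b, β)‖
          ≤ C * Real.exp (-(c * σ * m ^ 2)) * (1 + σ) / (1 + σ + (torusDist x z : ℝ) ^ 2) ^ 3 ∧
        ∀ μ : Fin 4,
          ‖(NormedSpace.exp (-(σ : ℂ) •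
              ((wilsonDirac (fundamentalRep (Fin 3)) (freeCfg L) m 1)ᴴ *
                wilsonDirac (fundamentalRep (Fin 3)) (freeCfg L) m 1))) (x, a, α) (z, b, β) -
            (NormedSpace.exp (-(σ : ℂ) •
              ((wilsonDirac (fundamentalRep (Fin 3)) (freeCfg L) m 1)ᴴ *
                wilsonDirac (fundamentalRep (Fin 3)) (freeCfg L) m 1))) (x, a, α) (Site.shift z μ, b, β)‖
          ≤ C * Real.exp (-(c * σ * m ^ 2)) * Real.sqrt (1 + σ) / (1 + σ + (torusDist x z : ℝ) ^ 2) ^ 3) →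
    (∃ κ : ℝ, 0 < κ ∧ ∃ C : ℝ, ∀ (L : ℕ) [NeZero L] (U : GaugeConfig 4 L SU3) (m : ℝ),
      m ∈ Set.Icc (-(1 / 2 : ℝ)) 1 → ∀ (x : TorusSite 4 L) (ℓ : ℕ), 1 ≤ ℓ → 4 * ℓ < L →
      (∀ z : TorusSite 4 L, torusDist x z ≤ 2 * ℓ →
        (∀ μ : Fin 4, 3 - ((fundamentalRep (Fin 3)) (U (z, μ))).trace.re ≤ (κ / (ℓ : ℝ)) ^ 2) ∧
        (∀ μ ν : Fin 4, 3 - ((fundamentalRep (Fin 3)) (plaquetteHolonomy U z μ ν)).trace.re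
          ≤ (κ / (ℓ : ℝ) ^ 2) ^ 2)) →
      ∀ s : ℝ, 1 ≤ s → s ≤ (ℓ : ℝ) ^ 2 → ∀ (a : Fin 3) (α : Fin 4),
        ∑ j, ‖(NormedSpace.exp (-(s : ℂ) •
            ((wilsonDirac (fundamentalRep (Fin 3)) U m 1)ᴴ * wilsonDirac (fundamentalRep (Fin 3)) U m 1)))
          (x, a, α) j‖ ^ 2 ≤ (C / s) ^ 2) := by
  sorry

/-- **Stub S4a (S) "GaugeCovariance" — gauge invariance of the colour-summed diagonal heat-kernel blocks
and of the plaquette traces.**  `D_W(g•U) = 𝒢 D_W(U) 𝒢⁻¹` (`wilsonDirac_gaugeTransform`,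
`WilsonFermionBlockAveraging`) with `𝒢 = gaugeRotation ρ (Fin 4) g` unitary (`ρ` unitary,
`gaugeRotation_mul_inv`), so `e^{-tH_{g•U}} = 𝒢 e^{-tH_U} 𝒢ᴴ` (`Matrix.exp_conj` /
`Matrix.exp_units_conj`); `𝒢` acts by `ρ(g x) ⊗ 1` on the `(x,x)` block, and
`Σ_a ρ(g x)_{ab} conj(ρ(g x)_{ac}) = δ_{bc}`, so the colour trace at fixed site and spin is invariant.
The plaquette holonomy transforms by conjugation (`plaquetteHolonomy (gaugeTransform g U) y μ ν =
g y * plaquetteHolonomy U y μ ν * (g y)⁻¹`, cf. the proof of `wilsonAction_gaugeTransform`), so its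
character is invariant.  SIZE: S. -/
theorem stub_gaugeCovariance :
    ∀ (L : ℕ) [NeZero L] (U : GaugeConfig 4 L SU3) (g : TorusSite 4 L → SU3) (m t : ℝ)
      (x : TorusSite 4 L),
      (∀ α : Fin 4,
        ∑ a : Fin 3, (NormedSpace.exp (-(t : ℂ) •
            ((wilsonDirac (fundamentalRep (Fin 3)) (gaugeTransform g U) m 1)ᴴ *
              wilsonDirac (fundamentalRep (Fin 3)) (gaugeTransform g U) m 1))) (x, a, α) (x, a, α) =
        ∑ a : Fin 3, (NormedSpace.exp (-(t : ℂ) •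
            ((wilsonDirac (fundamentalRep (Fin 3)) U m 1)ᴴ *
              wilsonDirac (fundamentalRep (Fin 3)) U m 1))) (x, a, α) (x, a, α)) ∧
      ∀ μ ν : Fin 4, ((fundamentalRep (Fin 3)) (plaquetteHolonomy (gaugeTransform g U) x μ ν)).trace =
        ((fundamentalRep (Fin 3)) (plaquetteHolonomy U x μ ν)).trace := by
  sorry

/-- **Stub S4c (S) "DiagonalMonotone" — the diagonal of the heat kernel of `AᴴA` is non-increasing in
time.**  For every complex square matrix `A` (finite index type in `Type`), index `i` and `0 ≤ t' ≤ t`: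
`Re e^{-tAᴴA}(i,i) ≤ Re e^{-t'AᴴA}(i,i)` (spectral theorem: `e^{-tAᴴA}(i,i) = Σ_k |u_{ik}|² e^{-tλ_k}`
with `λ_k ≥ 0`, cf. the proof of `norm_exp_neg_smul_conjTranspose_mul_self_apply_le_one` in
`Negative/LoadBearing.lean`; or T*T + `‖e^{-(t-t')H}‖ ≤ 1`).  SIZE: S (general linear algebra). -/
theorem stub_diagonalMonotone :
    ∀ (ι : Type) [Fintype ι] [DecidableEq ι] (A : Matrix ι ι ℂ) (i : ι) (t' t : ℝ), 0 ≤ t' → t' ≤ t →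
      ((NormedSpace.exp (-(t : ℂ) • (Aᴴ * A))) i i).re ≤ ((NormedSpace.exp (-(t' : ℂ) • (Aᴴ * A))) i i).re := by
  sorry

/-- **Stub S4 (M) "CombGauge → GaugeCovariance → DiagonalMonotone → LocalSupBound → DiagonalKernelBound":
comb gauge + scale arithmetic + T*T transfer.**  CONCLUSION ("DiagonalKernelBound"): the crux's
hypotheses imply the `C/t²` bound for the REAL PARTS of the DIAGONAL colour–spin entries (same quantifier
prefix as the crux; not a restatement of the crux: it is reached only through the four hypotheses).
PROOF SKETCH (constants only; `K = 1`; `κ, C₃` from the LocalSupBound hypothesis, `C_A` from CombGauge):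
(i) `r < 64` or `t < 64`: `Re e ≤ |e| ≤ 1 ≤ 64⁴/t²` by `kernelEntry_le_one` (LoadBearing);
(ii) otherwise `t' := min(t, r²/128)` (`≥ 32`), and DiagonalMonotone gives `Re e^{-tH}(i,i) ≤ Re e^{-t'H}(i,i)`;
(iii) `s := t'/2 ≥ 1`, `ℓ := ⌈√s⌉₊` so `s ≤ ℓ²`, `ℓ ≤ r/16 + 1 ≤ r/8`; comb radius `R := 2ℓ + 1 ≤ r = K r`,
and `2R + 1 = 4ℓ + 3 ≤ r ≤ L` (uses `r ≤ L`; gives `4ℓ < L`); (iv) CombGauge at `(x, R, δ := ε/r²)` ⇒ a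
gauge `g` with link deficits of `W := g•U` at `torusDist x z ≤ 2ℓ` (`= R - 1`) at most
`C_A(2ℓ+1)²ε²/r⁴ ≤ (κ/ℓ)²` once `ε ≤ κ/(8√(C_A+1))` — THE scale-covariance step; plaquette deficits of
`W` equal those of `U` (GaugeCovariance.2, real parts) `≤ (ε/r²)² ≤ (κ/ℓ²)²` as `ε ≤ κ`, `ℓ ≤ r`;
(v) LocalSupBound for `W` at `(x, ℓ, s)` and T*T `exp_neg_smul_apply_self_eq_sum_norm_sq`:
`e^{-t'H_W}((x,a,α),(x,a,α)) = Σ_j |e^{-sH_W}((x,a,α),j)|² ≤ (C₃/s)²` (real, `≥ 0`);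
(vi) GaugeCovariance.1: `Σ_a e^{-t'H_W}((x,a,α),(x,a,α)) = Σ_a e^{-t'H_U}((x,a,α),(x,a,α))`, every
diagonal entry has real part `≥ 0` (T*T), hence `Re e^{-t'H_U}((x,a,α),(x,a,α)) ≤ 3 (2C₃/t')²
≤ 12 C₃² 128²/t²` (`t' ≥ t/128` because `t ≤ r²`).  SIZE: M.  LEANS ON: as named;
`kernelEntry_le_one` (LoadBearing), `Nat.ceil`, `Real.sqrt` arithmetic. -/
theorem stub_gaugeTransfer :
    (∃ C_A : ℝ, ∀ (L : ℕ) [NeZero L] (U : GaugeConfig 4 L SU3) (x : TorusSite 4 L) (R : ℕ),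
      2 * R + 1 ≤ L → ∀ δ : ℝ, 0 ≤ δ →
      (∀ y : TorusSite 4 L, torusDist x y ≤ R → ∀ μ ν : Fin 4,
        3 - ((fundamentalRep (Fin 3)) (plaquetteHolonomy U y μ ν)).trace.re ≤ δ ^ 2) →
      ∃ g : TorusSite 4 L → SU3, ∀ z : TorusSite 4 L, torusDist x z + 1 ≤ R → ∀ μ : Fin 4,
        3 - ((fundamentalRep (Fin 3)) (gaugeTransform g U (z, μ))).trace.re
          ≤ C_A * ((torusDist x z : ℝ) + 1) ^ 2 * δ ^ 2) →
    (∀ (L : ℕ) [NeZero L] (U : GaugeConfig 4 L SU3) (g : TorusSite 4 L → SU3) (m t : ℝ)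
      (x : TorusSite 4 L),
      (∀ α : Fin 4,
        ∑ a : Fin 3, (NormedSpace.exp (-(t : ℂ) •
            ((wilsonDirac (fundamentalRep (Fin 3)) (gaugeTransform g U) m 1)ᴴ *
              wilsonDirac (fundamentalRep (Fin 3)) (gaugeTransform g U) m 1))) (x, a, α) (x, a, α) =
        ∑ a : Fin 3, (NormedSpace.exp (-(t : ℂ) •
            ((wilsonDirac (fundamentalRep (Fin 3)) U m 1)ᴴ *
              wilsonDirac (fundamentalRep (Fin 3)) U m 1))) (x, a, α) (x, a, α)) ∧
      ∀ μ ν : Fin 4, ((fundamentalRep (Fin 3)) (plaquetteHolonomy (gaugeTransform g U) x μ ν)).trace =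
        ((fundamentalRep (Fin 3)) (plaquetteHolonomy U x μ ν)).trace) →
    (∀ (ι : Type) [Fintype ι] [DecidableEq ι] (A : Matrix ι ι ℂ) (i : ι) (t' t : ℝ), 0 ≤ t' → t' ≤ t →
      ((NormedSpace.exp (-(t : ℂ) • (Aᴴ * A))) i i).re ≤ ((NormedSpace.exp (-(t' : ℂ) • (Aᴴ * A))) i i).re) →
    (∃ κ : ℝ, 0 < κ ∧ ∃ C : ℝ, ∀ (L : ℕ) [NeZero L] (U : GaugeConfig 4 L SU3) (m : ℝ),
      m ∈ Set.Icc (-(1 / 2 : ℝ)) 1 → ∀ (x : TorusSite 4 L) (ℓ : ℕ), 1 ≤ ℓ → 4 * ℓ < L →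
      (∀ z : TorusSite 4 L, torusDist x z ≤ 2 * ℓ →
        (∀ μ : Fin 4, 3 - ((fundamentalRep (Fin 3)) (U (z, μ))).trace.re ≤ (κ / (ℓ : ℝ)) ^ 2) ∧
        (∀ μ ν : Fin 4, 3 - ((fundamentalRep (Fin 3)) (plaquetteHolonomy U z μ ν)).trace.re
          ≤ (κ / (ℓ : ℝ) ^ 2) ^ 2)) →
      ∀ s : ℝ, 1 ≤ s → s ≤ (ℓ : ℝ) ^ 2 → ∀ (a : Fin 3) (α : Fin 4),
        ∑ j, ‖(NormedSpace.exp (-(s : ℂ) •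
            ((wilsonDirac (fundamentalRep (Fin 3)) U m 1)ᴴ * wilsonDirac (fundamentalRep (Fin 3)) U m 1)))
          (x, a, α) j‖ ^ 2 ≤ (C / s) ^ 2) →
    (∃ ε : ℝ, 0 < ε ∧ ∃ K : ℕ, ∃ C : ℝ, ∀ (L : ℕ) [NeZero L] (U : GaugeConfig 4 L SU3) (m : ℝ),
      m ∈ Set.Icc (-(1 / 2 : ℝ)) 1 → ∀ (x : TorusSite 4 L) (r : ℕ), 1 ≤ r → r ≤ L →
      (∀ y : TorusSite 4 L, torusDist x y ≤ K * r → ∀ μ ν : Fin 4,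
        3 - ((fundamentalRep (Fin 3)) (plaquetteHolonomy U y μ ν)).trace.re ≤ (ε / (r : ℝ) ^ 2) ^ 2) →
      ∀ t : ℝ, 1 ≤ t → t ≤ (r : ℝ) ^ 2 → ∀ (a : Fin 3) (α : Fin 4),
        ((NormedSpace.exp (-(t : ℂ) •
            ((wilsonDirac (fundamentalRep (Fin 3)) U m 1)ᴴ * wilsonDirac (fundamentalRep (Fin 3)) U m 1)))
          (x, a, α) (x, a, α)).re ≤ C / t ^ 2) := by
  sorry


/-! ### §2 Composition (no `sorry` below this line) -/

/-- **`SmallFieldUltracontractivity` from the seven stubs** (kernel-checked; uses the stubs BY NAME on its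
first lines and nothing else; conclusion is the route decl BY NAME).  Comb gauge (S1), covariance (S4a),
monotonicity (S4c) and the caloric bootstrap (S3, fed by the free decay S2) are turned into the diagonal
bound by the transfer (S4); the remaining colour–spin entries of the `(x,x)` block are dominated by the
diagonal real parts (`norm_sq_exp_neg_smul_apply_le`, with `0 ≤ Re e^{-tH}(i,i)` from
`exp_neg_smul_apply_self_eq_sum_norm_sq`, both LANDED in `Negative/Tightness.lean`), with the SAME
`ε, K, C`. -/
theorem SmallFieldUltracontractivity_of :
    Summit.QuantumFields.QCD.Theses.HeatSlicedQuarks.SmallFieldUltracontractivity := by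
  have h₁ := stub_combGauge
  have h₂f := stub_freeKernelFourier
  have h₂ := stub_freeKernelDecay h₂f
  have h₃ := stub_caloricBootstrap
  have h₄ := stub_gaugeCovariance
  have h₅ := stub_diagonalMonotone
  have h₆ := stub_gaugeTransfer
  obtain ⟨ε, hε, K, C, hC⟩ := h₆ h₁ h₄ h₅ (h₃ h₂)
  refine ⟨ε, hε, K, C, ?_⟩
  intro L _ U m hm x r hr hrL hflat t ht htr a b α β
  have hdiag := hC L U m hm x r hr hrL hflat t ht htr
  set D := wilsonDirac (fundamentalRep (Fin 3)) U m 1 with hD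
  have hi : ((NormedSpace.exp (-(t : ℂ) • (Dᴴ * D))) (x, a, α) (x, a, α)).re ≤ C / t ^ 2 := hdiag a α
  have hj : ((NormedSpace.exp (-(t : ℂ) • (Dᴴ * D))) (x, b, β) (x, b, β)).re ≤ C / t ^ 2 := hdiag b β
  have hre0 : ∀ i, 0 ≤ ((NormedSpace.exp (-(t : ℂ) • (Dᴴ * D))) i i).re := by
    intro i
    rw [exp_neg_smul_apply_self_eq_sum_norm_sq D t i, Complex.re_sum]
    exact Finset.sum_nonneg fun j _ => by rw [Complex.ofReal_re]; positivity
  have hCt : 0 ≤ C / t ^ 2 := (hre0 (x, a, α)).trans hi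
  have hsq : ‖(NormedSpace.exp (-(t : ℂ) • (Dᴴ * D))) (x, a, α) (x, b, β)‖ ^ 2 ≤ (C / t ^ 2) ^ 2 :=
    calc ‖(NormedSpace.exp (-(t : ℂ) • (Dᴴ * D))) (x, a, α) (x, b, β)‖ ^ 2
        ≤ ((NormedSpace.exp (-(t : ℂ) • (Dᴴ * D))) (x, a, α) (x, a, α)).re *
            ((NormedSpace.exp (-(t : ℂ) • (Dᴴ * D))) (x, b, β) (x, b, β)).re :=
          norm_sq_exp_neg_smul_apply_le D t (x, a, α) (x, b, β)
      _ ≤ (C / t ^ 2) * (C / t ^ 2) := mul_le_mul hi hj (hre0 (x, b, β)) hCt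
      _ = (C / t ^ 2) ^ 2 := by ring
  exact (sq_le_sq₀ (norm_nonneg _) hCt).mp hsq

/-- Strength check (kernel-checked): the conclusion "DiagonalKernelBound" of `stub_gaugeTransfer` is
implied by the crux itself (`Re z ≤ |z|`), so the transfer stub aims at exactly the crux's strength. -/
theorem diagonalKernelBound_of_crux
    (h : Summit.QuantumFields.QCD.Theses.HeatSlicedQuarks.SmallFieldUltracontractivity) :
    ∃ ε : ℝ, 0 < ε ∧ ∃ K : ℕ, ∃ C : ℝ, ∀ (L : ℕ) [NeZero L] (U : GaugeConfig 4 L SU3) (m : ℝ),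
      m ∈ Set.Icc (-(1 / 2 : ℝ)) 1 → ∀ (x : TorusSite 4 L) (r : ℕ), 1 ≤ r → r ≤ L →
      (∀ y : TorusSite 4 L, torusDist x y ≤ K * r → ∀ μ ν : Fin 4,
        3 - ((fundamentalRep (Fin 3)) (plaquetteHolonomy U y μ ν)).trace.re ≤ (ε / (r : ℝ) ^ 2) ^ 2) →
      ∀ t : ℝ, 1 ≤ t → t ≤ (r : ℝ) ^ 2 → ∀ (a : Fin 3) (α : Fin 4),
        ((NormedSpace.exp (-(t : ℂ) •
            ((wilsonDirac (fundamentalRep (Fin 3)) U m 1)ᴴ * wilsonDirac (fundamentalRep (Fin 3)) U m 1)))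
          (x, a, α) (x, a, α)).re ≤ C / t ^ 2 := by
  obtain ⟨ε, hε, K, C, hC⟩ := h
  refine ⟨ε, hε, K, C, ?_⟩
  intro L _ U m hm x r hr hrL hflat t ht htr a α
  exact ((le_abs_self _).trans (Complex.abs_re_le_norm _)).trans
    (hC L U m hm x r hr hrL hflat t ht htr a a α α)

end Summit.QuantumFields.QCD.Cruxes.SmallFieldUltracontractivity.PointCentredAxialParabolic
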